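import Literature.NumberTheory.LFunctions.HeilbronnBound
import HarnessLib

/-!
# Route `DedekindQuotient1951` (Langlands) — crux `QuinticDedekindPole` (stmt-Langlands-17270),
# line `Sketch`, stub `stub_indexTwoOrderLe`

Heilbronn bookkeeping for a quadratic step ([MurtyMurty1997, Ch. 2 §5]). For a number field `F`,
a finite group `G` exhibited as a Galois group over `F` by `q : Γ_F → G` (`IsArtinQuotient q`) and
subgroups `H' ≤ H ≤ G` with `[H : H'] = 2`, the fixed fields `F_H ⊆ F_{H'}` satisfy
`ord_{s₀} ζ_{F_H} ≤ ord_{s₀} ζ_{F_{H'}}` at EVERY point `s₀ ∈ ℂ`.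

Proof: as class functions on `G`, `Ind_{H'}^G 1 = Ind_H^G 1 + Ind_H^G ε` where `ε : H → {±1}`
is the quadratic character of `H` with kernel `H'` (`indClassFun_one_eq_add_of_relIndex_two`);
Heilbronn's integers `n(G, ·) = artinOrder s₀ (· ∘ q)` are additive (`artinOrder_comp_add`),
`n(G, Ind_H^G 1) = ord_{s₀} ζ_{F_H}` (`artinOrder_indClassFun_one`), and `n(G, Ind_H^G ε) ≥ 0`
because the `L`-function of the non-trivial character of degree one cut out by `(H, ε)` is
entire (`artinOrder_indClassFun_nonneg_of_ne_one`).

## References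

* M. R. Murty, V. K. Murty, *Non-vanishing of `L`-functions and applications*, Birkhäuser 1997,
  Ch. 2 §5. [MurtyMurty1997]
* J.-P. Serre, *Linear Representations of Finite Groups*, Springer 1977, §7.2.
  [SerreLinearRepresentations1977]
-/

set_option linter.dupNamespace false -- project-wide option; `Summit.Langlands.Langlands` is the mandated namespace

noncomputable section

open Complex

namespace Summit.Langlands.Langlands.Theorems.DedekindQuotient1951

open Literature.NumberTheory.LFunctions Literature.NumberTheory.LFunctions.Heilbronn
open Literature.NumberTheory.Automorphic Literature.NumberTheory.GaloisRepresentations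
open Literature.RepresentationTheory.FiniteGroups

/-- **The sign character of an index-two subgroup.** For a subgroup `N ≤ H` of index `2` there
is a homomorphism `ε : H →* ℂˣ` with `ε = 1` on `N` and `ε = -1` off `N` (a homomorphism because
`a * b ∈ N ↔ (a ∈ N ↔ b ∈ N)`, Mathlib `Subgroup.mul_mem_iff_of_index_two`). [folklore] -/
theorem exists_signChar_of_index_two {H : Type} [Group H] (N : Subgroup H) (hN : N.index = 2) :
    ∃ ε : H →* ℂˣ, (∀ h, h ∈ N → (ε h : ℂ) = 1) ∧ (∀ h, h ∉ N → (ε h : ℂ) = -1) := by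
  classical
  have hmul : ∀ a b : H, (if a * b ∈ N then (1 : ℂˣ) else -1) =
      (if a ∈ N then (1 : ℂˣ) else -1) * (if b ∈ N then 1 else -1) := by
    intro a b
    by_cases ha : a ∈ N <;> by_cases hb : b ∈ N
    · rw [if_pos ((Subgroup.mul_mem_iff_of_index_two hN).mpr (iff_of_true ha hb)), if_pos ha,
        if_pos hb, one_mul]
    · rw [if_neg (fun h => hb (((Subgroup.mul_mem_iff_of_index_two hN).mp h).mp ha)), if_pos ha,
        if_neg hb, one_mul]
    · rw [if_neg (fun h => ha (((Subgroup.mul_mem_iff_of_index_two hN).mp h).mpr hb)), if_neg ha,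
        if_pos hb, mul_one]
    · rw [if_pos ((Subgroup.mul_mem_iff_of_index_two hN).mpr (iff_of_false ha hb)), if_neg ha,
        if_neg hb, neg_mul_neg, one_mul]
  refine ⟨MonoidHom.mk' (fun h => if h ∈ N then 1 else -1) hmul, fun h hh => ?_, fun h hh => ?_⟩
  · rw [MonoidHom.mk'_apply, if_pos hh, Units.val_one]
  · rw [MonoidHom.mk'_apply, if_neg hh, Units.val_neg, Units.val_one]

/-- **`Ind_{H'}^G 1 = Ind_H^G 1 + Ind_H^G ε`** for subgroups `H' ≤ H ≤ G` with `[H : H'] = 2` and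
`ε` the quadratic character of `H` with kernel `H'`: pointwise in Serre's formula
`Ind f (s) = |H|⁻¹ ∑_t f̃(t⁻¹ s t)`, for `x = t⁻¹ s t` one has `1̃_H(x) + ε̃(x) = 2 · 1̃_{H'}(x)`
and `|H| = 2 |H'|` (transitivity of induction applied to the regular character `1 + ε` of
`H/H'`). [cite: SerreLinearRepresentations1977, §7.2] -/
theorem indClassFun_one_eq_add_of_relIndex_two {G : Type} [Group G] [Fintype G]
    {H H' : Subgroup G} (hle : H' ≤ H) (hidx : H'.relIndex H = 2) {ε : H →* ℂˣ}
    (hε₁ : ∀ h : H, (h : G) ∈ H' → (ε h : ℂ) = 1) (hε₂ : ∀ h : H, (h : G) ∉ H' → (ε h : ℂ) = -1) :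
    indClassFun H' (fun _ => (1 : ℂ)) =
      indClassFun H (fun _ => (1 : ℂ)) + indClassFun H (fun h => (ε h : ℂ)) := by
  -- pointwise identity of the extensions by zero
  have hx : ∀ x : G, Function.extend (Subtype.val : H → G) (fun _ => (1 : ℂ)) 0 x +
      Function.extend (Subtype.val : H → G) (fun h => (ε h : ℂ)) 0 x =
        2 * Function.extend (Subtype.val : H' → G) (fun _ => (1 : ℂ)) 0 x := by
    intro x
    by_cases hxH : x ∈ H
    · have e1 : Function.extend (Subtype.val : H → G) (fun _ => (1 : ℂ)) 0 x = 1 :=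
        extend_subtypeVal_apply H (fun _ => (1 : ℂ)) ⟨x, hxH⟩
      have e2 : Function.extend (Subtype.val : H → G) (fun h => (ε h : ℂ)) 0 x = ε ⟨x, hxH⟩ :=
        extend_subtypeVal_apply H (fun h => (ε h : ℂ)) ⟨x, hxH⟩
      rw [e1, e2]
      by_cases hxH' : x ∈ H'
      · have e3 : Function.extend (Subtype.val : H' → G) (fun _ => (1 : ℂ)) 0 x = 1 :=
          extend_subtypeVal_apply H' (fun _ => (1 : ℂ)) ⟨x, hxH'⟩
        rw [e3, hε₁ ⟨x, hxH⟩ hxH']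
        norm_num
      · rw [extend_subtypeVal_of_not_mem H' _ hxH', hε₂ ⟨x, hxH⟩ hxH']
        norm_num
    · have hxH' : x ∉ H' := fun h => hxH (hle h)
      rw [extend_subtypeVal_of_not_mem H _ hxH, extend_subtypeVal_of_not_mem H _ hxH,
        extend_subtypeVal_of_not_mem H' _ hxH']
      norm_num
  -- the cardinalities: `|H| = 2 |H'|`
  have hcard : (Nat.card H : ℂ) = 2 * Nat.card H' := by
    have h := Subgroup.relIndex_mul_relIndex ⊥ H' H bot_le hle
    rw [Subgroup.relIndex_bot_left, Subgroup.relIndex_bot_left, hidx] at h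
    rw [← h]
    push_cast
    ring
  have hH' : (Nat.card H' : ℂ) ≠ 0 := Nat.cast_ne_zero.mpr Nat.card_pos.ne'
  funext s
  simp only [Pi.add_apply, indClassFun_apply]
  rw [← mul_add, ← Finset.sum_add_distrib, Finset.sum_congr rfl fun t _ => hx (t⁻¹ * s * t),
    ← Finset.mul_sum, ← mul_assoc, hcard]
  congr 1
  field_simp

/-- `Ind_H^G 1` (the permutation character of `G/H`) is a character of `G`. [folklore] -/
theorem isCharacter_indClassFun_const_one {G : Type} [Group G] [Fintype G] (H : Subgroup G) :
    IsCharacter G (indClassFun H (fun _ => (1 : ℂ))) := by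
  rw [← indClassFun_one_coe]
  exact isCharacter_indClassFun_monoidHom H 1

/-- **stub_indexTwoOrderLe** (a quadratic step costs nothing): for a finite Galois quotient
`q : Γ_F → G` and subgroups `H' ≤ H` with `[H : H'] = 2`, `ord_{s₀} ζ_{F_H} ≤ ord_{s₀} ζ_{F_{H'}}`
at every `s₀` (`Ind_{H'} 1 = Ind_H 1 + Ind_H ε` with `ε` the quadratic character of `H/H'`, and
`n(G, Ind_H ε) ≥ 0` since `L(s, Ind_H^G ε)` is the entire Hecke `L`-function of a non-trivial
character of degree one of `Γ_{F_H}`: `artinOrder_indClassFun_nonneg_of_ne_one`,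
`artinOrder_indClassFun_one`, `artinOrder_comp_add`). [cite: MurtyMurty1997, Ch. 2 §5] -/
theorem stub_indexTwoOrderLe {F : Type} [Field F] [NumberField F] {G : Type} [Group G] [Fintype G]
    {q : Field.absoluteGaloisGroup F →* G} (hq : IsArtinQuotient q) (H H' : Subgroup G) (hle : H' ≤ H)
    (hidx : H'.relIndex H = 2) [NumberField (quotientFixedField q H)] [NumberField (quotientFixedField q H')]
    (s₀ : ℂ) :
    meromorphicOrderAt (dedekindZetaCont (quotientFixedField q H)) s₀ ≤
      meromorphicOrderAt (dedekindZetaCont (quotientFixedField q H')) s₀ := by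
  -- the quadratic character `ε` of `H` with kernel `N = H' ∩ H = H'` (index 2 in `H`)
  have hN : (H'.subgroupOf H).index = 2 := hidx
  obtain ⟨ε, hε₁, hε₂⟩ := exists_signChar_of_index_two (H'.subgroupOf H) hN
  have hε₁' : ∀ h : H, (h : G) ∈ H' → (ε h : ℂ) = 1 := fun h hh =>
    hε₁ h (Subgroup.mem_subgroupOf.mpr hh)
  have hε₂' : ∀ h : H, (h : G) ∉ H' → (ε h : ℂ) = -1 := fun h hh =>
    hε₂ h (fun hm => hh (Subgroup.mem_subgroupOf.mp hm))
  -- `ε ≠ 1` since `H' ∩ H ≠ H`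
  have hne : ε ≠ 1 := by
    obtain ⟨a, haN, -⟩ := Subgroup.index_eq_two_iff_exists_notMem_and.mp hN
    intro h1
    have h := hε₂ a haN
    rw [h1, MonoidHom.one_apply, Units.val_one] at h
    norm_num at h
  -- `n(Ind_{H'} 1) = n(Ind_H 1) + n(Ind_H ε)` and `n(Ind_H ε) ≥ 0`
  have hrel := indClassFun_one_eq_add_of_relIndex_two hle hidx hε₁' hε₂'
  have hsum := congrArg (fun f : G → ℂ => artinOrder s₀ (f ∘ q)) hrel
  rw [artinOrder_comp_add hq s₀ (isCharacter_indClassFun_const_one H)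
    (isCharacter_indClassFun_monoidHom H ε)] at hsum
  have hnn := artinOrder_indClassFun_nonneg_of_ne_one hq s₀ H hne
  have hle' : artinOrder s₀ (indClassFun H (fun _ => (1 : ℂ)) ∘ q) ≤
      artinOrder s₀ (indClassFun H' (fun _ => (1 : ℂ)) ∘ q) := by
    omega
  rw [← artinOrder_indClassFun_one hq s₀ H, ← artinOrder_indClassFun_one hq s₀ H']
  exact_mod_cast hle'

end Summit.Langlands.Langlands.Theorems.DedekindQuotient1951

end
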